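import Mathlib.MeasureTheory.Measure.Haar.MulEquivHaarChar
import Mathlib.MeasureTheory.Constructions.Pi
import Mathlib.MeasureTheory.Measure.Prod
import HarnessLib

/-!
# K2 ∕ E5 «TamagawaUnitary», unit G — helper `K2E5HaarCharProduct`: the Haar character of a PRODUCT of additive automorphisms is the product of the Haar characters

Cell `hodgecm-mathlib` (Track B «K2-LIT»), item h413 = `stmt-HodgeConjecture-24833`; socket G8 `Zeta.sig_K2E5QuatLocalZetaAtOne` (K2E5-p19), brick [J2] «modulus law
`dx_v(g·S) = ‖g‖_v dx_v(S)` on `D_v`» of the road of record (K2/STATUS.md 2026-09-03T23:33Z∕23:5xZ).  PROOF lane, helper (`--supports stmt-HodgeConjecture-24833 --as helper`);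
author K2E5-p19 (g0).  Pure measure theory (Mathlib only): for second-countable locally compact abelian groups,

* `addEquivAddHaarChar_eq_mul_of_prod` — if `Φ : A × B ≃ₜ+ A × B` acts as `(φ, ψ)` componentwise then `χ(Φ) = χ(φ)·χ(ψ)` (Mathlib `addEquivAddHaarChar`; Fubini-free: Haar
  uniqueness on the product, `Measure.map_prod_map`, `Measure.prod_smul_left∕right`);
* `addEquivAddHaarChar_eq_prod_of_pi` — if `Φ : (Π i, A i) ≃ₜ+ (Π i, A i)` acts as `(φ i)_i` then `χ(Φ) = Π_i χ(φ i)` (`Measure.pi_map_pi`, `Measure.pi_eq`).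

Used to read the Haar character of left multiplication by `g ∈ (D_v)^×` on `M₂(E_v) = D_v ⊕ δ·D_v = Π_{w∣v} Π_{columns} E_w²` (★ `K2E5QuatLocalLeftMulModulus`).
HONEST LABEL: HC_CM is proved only modulo the 7 printed citations (2 remaining named inputs: hLiu418 = stmt-HodgeConjecture-24832,
h413 = stmt-HodgeConjecture-24833) until rung 0 closes; this helper closes no socket and changes no count.

## References
* [WeilBNT1967] A. Weil, *Basic Number Theory* (1967) — Ch. I §2 (the module of an automorphism; modules of products multiply).
* [Bourbaki-INT7] N. Bourbaki, *Intégration* Ch. VII §1 no. 4 (module d'un automorphisme, produits) — orientation only; every declaration is Mathlib-proved. [folklore]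
-/

set_option autoImplicit false
set_option linter.dupNamespace false

noncomputable section

namespace Summit.HodgeConjecture.HodgeConjecture.Cruxes.H413.K2E5HaarCharProduct

open MeasureTheory MeasureTheory.Measure TopologicalSpace
open scoped NNReal ENNReal

/-- From `χ(φ) • map φ μ = μ`: `map φ μ = χ(φ)⁻¹ • μ`. [cite: WeilBNT1967, Ch. I §2] -/
theorem map_eq_inv_smul {A : Type*} [AddGroup A] [TopologicalSpace A] [MeasurableSpace A] [BorelSpace A] [IsTopologicalAddGroup A]
    [LocallyCompactSpace A] (μ : Measure A) [μ.IsAddHaarMeasure] [μ.Regular] (φ : A ≃ₜ+ A) :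
    μ.map φ = (addEquivAddHaarChar φ)⁻¹ • μ := by
  have h := congrArg (fun ν : Measure A => (addEquivAddHaarChar φ)⁻¹ • ν) (addEquivAddHaarChar_smul_map μ φ)
  simp only [smul_smul, inv_mul_cancel₀ (addEquivAddHaarChar_pos φ).ne', one_smul] at h
  exact h

/-- The scalar is pinned: if `c • μ = μ` (`c : ℝ≥0`) and `μ s ∈ (0, ∞)` for some `s`, then `c = 1`. [folklore] -/
theorem eq_one_of_smul_eq {A : Type*} [MeasurableSpace A] (μ : Measure A) {s : Set A} (hs0 : μ s ≠ 0) (hst : μ s ≠ ∞) {c : ℝ≥0} (h : c • μ = μ) : c = 1 := by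
  have h' := congrArg (fun ν : Measure A => ν s) h
  simp only [Measure.coe_nnreal_smul_apply] at h'
  exact ENNReal.coe_eq_one.1 ((ENNReal.mul_eq_right hs0 hst).1 h')

/-- `a (b⁻¹ c⁻¹) = 1 ⇒ a = b c` in `ℝ≥0` (`b, c ≠ 0`). [folklore] -/
theorem eq_mul_of_mul_inv_inv_eq_one {a b c : ℝ≥0} (hb : b ≠ 0) (hc : c ≠ 0) (h : a * (b⁻¹ * c⁻¹) = 1) : a = b * c := by
  have h2 : a = a * (b⁻¹ * c⁻¹) * (b * c) := by
    rw [mul_assoc, show b⁻¹ * c⁻¹ * (b * c) = (b⁻¹ * b) * (c⁻¹ * c) by ring, inv_mul_cancel₀ hb, inv_mul_cancel₀ hc, mul_one, mul_one]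
  rw [h2, h, one_mul]

section Prod

variable {A B : Type*} [AddCommGroup A] [TopologicalSpace A] [IsTopologicalAddGroup A] [LocallyCompactSpace A] [SecondCountableTopology A]
  [MeasurableSpace A] [BorelSpace A]
  [AddCommGroup B] [TopologicalSpace B] [IsTopologicalAddGroup B] [LocallyCompactSpace B] [SecondCountableTopology B]
  [MeasurableSpace B] [BorelSpace B]

/-- **`χ(φ × ψ) = χ(φ) · χ(ψ)`**: the Haar character of an additive automorphism of `A × B` acting componentwise is the product of the Haar characters (second countable
locally compact abelian groups; Haar uniqueness on the product, `Measure.map_prod_map`). [cite: WeilBNT1967, Ch. I §2] -/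
theorem addEquivAddHaarChar_eq_mul_of_prod (Φ : (A × B) ≃ₜ+ (A × B)) (φ : A ≃ₜ+ A) (ψ : B ≃ₜ+ B) (hΦ : ∀ p : A × B, Φ p = (φ p.1, ψ p.2)) :
    addEquivAddHaarChar Φ = addEquivAddHaarChar φ * addEquivAddHaarChar ψ := by
  set μ : Measure A := Measure.addHaar with hμ
  set ν : Measure B := Measure.addHaar with hν
  have hφm : Measurable (φ : A → A) := φ.continuous.measurable
  have hψm : Measurable (ψ : B → B) := ψ.continuous.measurable
  have hP := addEquivAddHaarChar_smul_map (μ.prod ν) Φ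
  have hmap : (μ.prod ν).map Φ = (addEquivAddHaarChar φ)⁻¹ • ((addEquivAddHaarChar ψ)⁻¹ • μ.prod ν) := by
    have e : (Φ : A × B → A × B) = Prod.map φ ψ := funext fun p => by rw [hΦ p]; rfl
    rw [e, ← Measure.map_prod_map μ ν hφm hψm, map_eq_inv_smul μ φ, map_eq_inv_smul ν ψ, Measure.prod_smul_left, Measure.prod_smul_right]
  rw [hmap, smul_smul, smul_smul] at hP
  obtain ⟨K⟩ := (inferInstance : Nonempty (PositiveCompacts (A × B)))
  have hK0 : (μ.prod ν) (K : Set (A × B)) ≠ 0 := (Measure.measure_pos_of_nonempty_interior _ K.interior_nonempty).ne'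
  have hKt : (μ.prod ν) (K : Set (A × B)) ≠ ∞ := K.isCompact.measure_lt_top.ne
  have h1 := eq_one_of_smul_eq (μ.prod ν) hK0 hKt hP
  rw [mul_assoc] at h1
  exact eq_mul_of_mul_inv_inv_eq_one (addEquivAddHaarChar_pos φ).ne' (addEquivAddHaarChar_pos ψ).ne' h1

end Prod

section Pi

variable {ι : Type*} [Fintype ι] {A : ι → Type*} [∀ i, AddCommGroup (A i)] [∀ i, TopologicalSpace (A i)] [∀ i, IsTopologicalAddGroup (A i)]
  [∀ i, LocallyCompactSpace (A i)] [∀ i, SecondCountableTopology (A i)] [∀ i, MeasurableSpace (A i)] [∀ i, BorelSpace (A i)]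

/-- **`χ(Π_i φ_i) = Π_i χ(φ_i)`**: the Haar character of an additive automorphism of a finite product acting componentwise is the product of the Haar characters
(`Measure.pi_eq` on boxes). [cite: WeilBNT1967, Ch. I §2] -/
theorem addEquivAddHaarChar_eq_prod_of_pi (Φ : (∀ i, A i) ≃ₜ+ (∀ i, A i)) (φ : ∀ i, A i ≃ₜ+ A i) (hΦ : ∀ (x : ∀ i, A i) (i : ι), Φ x i = φ i (x i)) :
    addEquivAddHaarChar Φ = ∏ i, addEquivAddHaarChar (φ i) := by
  classical
  set μ : ∀ i, Measure (A i) := fun i => Measure.addHaar with hμ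
  have hP := addEquivAddHaarChar_smul_map (Measure.pi μ) Φ
  have hΦm : Measurable (Φ : (∀ i, A i) → ∀ i, A i) := Φ.continuous.measurable
  have hφm : ∀ i, Measurable (φ i : A i → A i) := fun i => (φ i).continuous.measurable
  have hpre : ∀ s : ∀ i, Set (A i), (Φ : (∀ i, A i) → ∀ i, A i) ⁻¹' Set.pi Set.univ s = Set.pi Set.univ fun i => (φ i) ⁻¹' s i := by
    intro s; ext x
    simp only [Set.mem_preimage, Set.mem_univ_pi, hΦ]
  have hmap : (Measure.pi μ).map Φ = (∏ i, (addEquivAddHaarChar (φ i))⁻¹) • Measure.pi μ := by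
    have hA : Measure.pi (fun i => (addEquivAddHaarChar (φ i))⁻¹ • μ i) = (Measure.pi μ).map Φ := by
      refine Measure.pi_eq fun s hs => ?_
      rw [Measure.map_apply hΦm (MeasurableSet.univ_pi hs), hpre, Measure.pi_pi]
      refine Finset.prod_congr rfl fun i _ => ?_
      rw [← Measure.map_apply (hφm i) (hs i), map_eq_inv_smul (μ i) (φ i)]
    have hB : Measure.pi (fun i => (addEquivAddHaarChar (φ i))⁻¹ • μ i) = (∏ i, (addEquivAddHaarChar (φ i))⁻¹) • Measure.pi μ := by
      refine Measure.pi_eq fun s _ => ?_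
      simp only [Measure.coe_nnreal_smul_apply, Measure.pi_pi, Finset.prod_mul_distrib]
      push_cast
      rfl
    rw [← hA, hB]
  rw [hmap, smul_smul] at hP
  obtain ⟨K⟩ := (inferInstance : Nonempty (PositiveCompacts (∀ i, A i)))
  have hK0 : (Measure.pi μ) (K : Set (∀ i, A i)) ≠ 0 := (Measure.measure_pos_of_nonempty_interior _ K.interior_nonempty).ne'
  have hKt : (Measure.pi μ) (K : Set (∀ i, A i)) ≠ ∞ := K.isCompact.measure_lt_top.ne
  have h1 := eq_one_of_smul_eq (Measure.pi μ) hK0 hKt hP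
  have hne : (∏ i, addEquivAddHaarChar (φ i)) ≠ 0 := Finset.prod_ne_zero_iff.2 fun i _ => (addEquivAddHaarChar_pos (φ i)).ne'
  rw [Finset.prod_inv_distrib] at h1
  calc addEquivAddHaarChar Φ = addEquivAddHaarChar Φ * ((∏ i, addEquivAddHaarChar (φ i))⁻¹ * ∏ i, addEquivAddHaarChar (φ i)) := by
        rw [inv_mul_cancel₀ hne, mul_one]
    _ = ∏ i, addEquivAddHaarChar (φ i) := by rw [← mul_assoc, h1, one_mul]

end Pi

end Summit.HodgeConjecture.HodgeConjecture.Cruxes.H413.K2E5HaarCharProduct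

end
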